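import Literature.Barriers.RiemannHypothesis.NymanBeurlingObstructions
import Literature.NumberTheory.LFunctions.MertensOmegaSqrt
import Literature.NumberTheory.LFunctions.NymanBeurlingVectorsOrthogonal
import Literature.NumberTheory.LFunctions.NymanBeurlingVectorsNorms
import Literature.NumberTheory.LFunctions.ZetaZerosProofs
import HarnessLib

/-!
# Proofs for `NymanBeurlingObstructions`: Báez-Duarte 2000, Proposition 4.4 (`L²` clause for `S_n`), and the BDBLS 2000 / Burnol 2002 lower bound `liminf D(λ)√(log(1/λ)) ≥ √(∑_ρ 1/|ρ|²)` — both proved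

This sibling proof file has two independent parts. **Part I** (immediately below) discharges
`BaezDuarte2000_prop4_4`. **Part II** (second half of the file, section docstring
"Proof of the BDBLS lower bound") discharges `BDBLS2000_thm` as
`Literature.Barriers.RiemannHypothesis.BDBLS2000_thm_holds`, assembling the Mellin-side version of
Burnol's argument developed in `Literature/NumberTheory/LFunctions/NymanBeurlingVectors*.lean`.

## Part I. Báez-Duarte 2000, Proposition 4.4 (`L²` clause for `S_n`) — proved

Sibling proof file of `Literature/Barriers/RiemannHypothesis/NymanBeurlingObstructions.lean`: it
discharges the vendored no-go fact

* `Literature.Barriers.RiemannHypothesis.BaezDuarte2000_prop4_4` — the natural Möbius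
  approximation `S_n(x) = ∑_{k ≤ n} μ(k) ρ(1/(kx))` does not converge to `−χ` in `L²(0,∞)`:
  `‖χ + S_n‖₂ ↛ 0` (`¬ Tendsto naturalError atTop (𝓝 0)`),

as `Literature.Barriers.RiemannHypothesis.BaezDuarte2000_prop4_4_holds`, fully proved (no named
fact is assumed; no axioms beyond Mathlib's).

## Source and printed proof

L. Báez-Duarte, *Arithmetical aspects of Beurling's real variable reformulation of the Riemann
hypothesis*, arXiv:math/0011254 (2000), §4, p. 11, Proposition 4.4: "If there is some zero of
`ζ(s)` with real part `1/p` then `S_n` and `V_n` diverge in `L_p`. In particular `S_n` and `V_n`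
diverge in `L₂`." Printed proof: by Corollary 2.1 the zero gives `g(n) ≠ o(n^{-1/q})`
(`g(n) = ∑_{k ≤ n} μ(k)/k`); if `S_n → −χ` in `L_p` then, since `kx > 1` for `x > 1/m`, `k > m`,
`‖S_n − S_m‖_p^p ≥ ∫_{1/m}^∞ |∑_{k=m+1}^n μ(k)ρ(1/(kx))|^p dx = m^{p−1}|g(n) − g(m)|^p/(p−1)`, and
`n → ∞` gives `‖χ + S_m‖_p^p ≥ m^{p−1}|g(m)|^p/(p−1) → 0`, a contradiction. For `p = 2` the last
display is `‖χ + S_n‖₂ ≥ |g(n)|√n` (first line of the proof of Proposition 4.5, p. 11).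

## The argument here (same mechanism, the limit `n → ∞` replaced by an exact evaluation)

1. (`nbChi_sub_sum_naturalCoeff_eq_div`) For `n ≥ 1` and `x > 1/n`, writing `t = 1/x < n`:
   `∑_{k ≤ n} μ(k){t/k} = t·g(n) − ∑_{k ≤ n} μ(k)⌊⌊t⌋/k⌋ = t·g(n) − [t ≥ 1]` by the classical
   `∑_{k ≤ N} μ(k)⌊N/k⌋ = 1` (`N ≥ 1`; Mathlib `ArithmeticFunction.sum_Ioc_mul_zeta_eq_sum` with
   `μ * ζ = 1`), so that `χ(x) + S_n(x) = g(n)/x` on all of `(1/n, ∞)` — for every `n`, not only in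
   the limit.
2. (`ofReal_moebiusHarmonic_le_naturalError`) Hence
   `‖χ + S_n‖_{L²(0,∞)} ≥ ‖g(n)/x‖_{L²(1/n,∞)} = |g(n)|√n` (`∫_{1/n}^∞ x^{-2} dx = n`), which is the
   `p = 2` case of the printed inequality and the second half of Proposition 4.5.
3. (`BaezDuarte2000_prop4_4_holds`) If `‖χ + S_n‖₂ → 0` then `|g(n)|√n → 0`, contradicting
   Corollary 2.1 (`p = 2`), which the tree PROVES as
   `Literature.NumberTheory.LFunctions.not_tendsto_abs_sum_moebius_div_mul_sqrt`
   (`MertensOmegaSqrt.lean`: Titchmarsh Thm. 14.26 (B) `M(x) ≠ o(√x)` from a kernel-checked zero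
   `½ + iγ₀`, `γ₀ ∈ [225/16, 227/16]`, and partial summation).

## References

* [BaezDuarte2000] L. Báez-Duarte, *Arithmetical aspects of Beurling's real variable reformulation
  of the Riemann hypothesis*, arXiv:math/0011254 (2000), §4 p. 11, Props. 4.4–4.5 with proofs;
  §2.2 Cor. 2.1 (read).
* [Titchmarsh1986] E. C. Titchmarsh, *The Theory of the Riemann Zeta-Function*, 2nd ed., Oxford
  1986, Thm. 14.26 (B) (through `MertensOmegaSqrt.lean`).
-/

noncomputable section

open MeasureTheory Filter Set
open scoped Topology ENNReal ArithmeticFunction.Moebius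

namespace Literature.Barriers.RiemannHypothesis

/-! ## The Möbius identity `∑_{k ≤ N} μ(k) ⌊N/k⌋ = 1` -/

/-- The classical identity `∑_{k ≤ N} μ(k) ⌊N/k⌋ = 1` for `N ≥ 1` (summing
`∑_{d ∣ m} μ(d) = [m = 1]` over `m ≤ N`), in `ℝ`. [folklore] -/
theorem sum_moebius_mul_div_eq_one {N : ℕ} (hN : 1 ≤ N) :
    ∑ k ∈ Finset.Ioc 0 N, (μ k : ℝ) * ((N / k : ℕ) : ℝ) = 1 := by
  have h := ArithmeticFunction.sum_Ioc_mul_zeta_eq_sum (μ : ArithmeticFunction ℝ) N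
  rw [ArithmeticFunction.coe_moebius_mul_coe_zeta] at h
  have h1 : ∑ n ∈ Finset.Ioc 0 N, (1 : ArithmeticFunction ℝ) n = 1 := by
    rw [Finset.sum_eq_single 1]
    · simp
    · intro b _ hb
      simp [hb]
    · intro h1
      exact absurd (Finset.mem_Ioc.2 ⟨Nat.one_pos, hN⟩) h1
  rw [h1] at h
  rw [h]
  exact Finset.sum_congr rfl fun k _ ↦ by rw [ArithmeticFunction.intCoe_apply]

/-- For real `t ≥ 0` and `n ≥ ⌊t⌋`: `∑_{k ≤ n} μ(k) ⌊t/k⌋ = [t ≥ 1]` (the terms with `k > ⌊t⌋`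
vanish and `⌊t/k⌋ = ⌊⌊t⌋/k⌋`). [folklore] -/
theorem sum_moebius_mul_floor_div_eq {t : ℝ} (ht : 0 ≤ t) {n : ℕ} (hn : ⌊t⌋₊ ≤ n) :
    ∑ k ∈ Finset.Ioc 0 n, (μ k : ℝ) * (⌊t / k⌋ : ℝ) = if 1 ≤ t then 1 else 0 := by
  -- `⌊t/k⌋ = ⌊⌊t⌋₊ / k⌋₊`, as a real number
  have hfl : ∀ k : ℕ, ((⌊t / k⌋ : ℤ) : ℝ) = ((⌊t⌋₊ / k : ℕ) : ℝ) := by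
    intro k
    rw [← natCast_floor_eq_intCast_floor (by positivity : (0 : ℝ) ≤ t / k),
      Nat.floor_div_natCast]
  simp_rw [hfl]
  -- drop the terms `⌊t⌋₊ < k ≤ n`
  rw [← Finset.sum_subset (Finset.Ioc_subset_Ioc_right hn)]
  · split_ifs with h1
    · exact sum_moebius_mul_div_eq_one ((Nat.one_le_floor_iff t).2 h1)
    · have h0 : ⌊t⌋₊ = 0 := by
        have : ¬ 1 ≤ ⌊t⌋₊ := fun h ↦ h1 ((Nat.one_le_floor_iff t).1 h)
        omega
      rw [h0]
      rfl
  · intro k hk hk'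
    rw [Finset.mem_Ioc] at hk hk'
    have hlt : ⌊t⌋₊ < k := by
      by_contra hle
      exact hk' ⟨hk.1, not_lt.1 hle⟩
    rw [Nat.div_eq_of_lt hlt, Nat.cast_zero, mul_zero]

/-! ## `χ + S_n = g(n)/x` on `(1/n, ∞)` -/

/-- `naturalError n = ‖χ − ∑_{j<n} c_j ρ_{j+1}‖_{L²(0,∞)}` with `c_j = −μ(j+1)`, i.e.
`‖χ + S_n‖₂` (definitional unfolding). [cite: BaezDuarte2000, §1.2 (1.12)] -/
theorem naturalError_eq_eLpNorm (n : ℕ) :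
    naturalError n = eLpNorm (fun x : ℝ ↦
      nbChi x - ∑ j : Fin n, naturalCoeff n j * beurlingRho (((j : ℕ) : ℝ) + 1) x) 2
      (volume.restrict (Ioi 0)) :=
  rfl

/-- Reindexing: `∑_{j : Fin n} (−μ(j+1)) ρ_{j+1}(x) = −∑_{k=1}^{n} μ(k) {1/(kx)}`. [folklore] -/
theorem sum_naturalCoeff_mul_beurlingRho (n : ℕ) (x : ℝ) :
    ∑ j : Fin n, naturalCoeff n j * beurlingRho (((j : ℕ) : ℝ) + 1) x =
      -∑ k ∈ Finset.Ioc 0 n, (μ k : ℝ) * Int.fract (1 / (k * x)) := by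
  simp only [naturalCoeff, beurlingRho]
  rw [Fin.sum_univ_eq_sum_range (fun j ↦ -(μ (j + 1) : ℝ) * Int.fract (1 / (((j : ℝ) + 1) * x))) n,
    ← Finset.sum_neg_distrib]
  induction n with
  | zero => simp
  | succ n ih =>
    rw [Finset.sum_range_succ, ih, Finset.sum_Ioc_succ_top (Nat.zero_le n)]
    push_cast
    ring

/-- **`χ + S_n = g(n)/x` on `(1/n, ∞)`** (`n ≥ 1`): for `x > 1/n`, with `t = 1/x < n`,
`∑_{k ≤ n} μ(k){t/k} = t g(n) − [t ≥ 1]` and `χ(x) = [t ≥ 1]`. This is the computation behind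
"noting that `kx > 1` when `x > 1/m` and `k > m`" in the printed proof.
[cite: BaezDuarte2000, Prop. 4.4 (proof), p. 11] -/
theorem nbChi_sub_sum_naturalCoeff_eq_div {n : ℕ} (hn : 1 ≤ n) {x : ℝ}
    (hx : x ∈ Ioi (1 / (n : ℝ))) :
    nbChi x - ∑ j : Fin n, naturalCoeff n j * beurlingRho (((j : ℕ) : ℝ) + 1) x =
      moebiusHarmonic n / x := by
  have hn0 : (0 : ℝ) < n := by exact_mod_cast hn
  have hxn : 1 / (n : ℝ) < x := hx
  have hx0 : 0 < x := lt_trans (by positivity) hxn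
  set t : ℝ := 1 / x with ht
  have ht0 : 0 < t := by positivity
  have htn : t < n := by
    rw [ht, div_lt_iff₀ hx0]
    calc (1 : ℝ) = n * (1 / (n : ℝ)) := by field_simp
      _ < n * x := by gcongr
  have hfloor : ⌊t⌋₊ ≤ n := Nat.floor_le_of_le htn.le
  -- the indicator
  have hchi : nbChi x = if 1 ≤ t then 1 else 0 := by
    unfold nbChi
    by_cases h1 : x ≤ 1
    · rw [indicator_of_mem (show x ∈ Ioc (0 : ℝ) 1 from ⟨hx0, h1⟩), Pi.one_apply, if_pos]
      rw [ht, le_div_iff₀ hx0, one_mul]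
      exact h1
    · rw [indicator_of_notMem (show x ∉ Ioc (0 : ℝ) 1 from fun h ↦ h1 h.2), if_neg]
      rw [ht, le_div_iff₀ hx0, one_mul]
      exact h1
  -- the Möbius sum
  have hsum : ∑ k ∈ Finset.Ioc 0 n, (μ k : ℝ) * Int.fract (1 / (k * x)) =
      t * moebiusHarmonic n - if 1 ≤ t then 1 else 0 := by
    rw [← sum_moebius_mul_floor_div_eq ht0.le hfloor, moebiusHarmonic,
      show Finset.Icc 1 n = Finset.Ioc 0 n from Finset.Icc_add_one_left_eq_Ioc 0 n,
      Finset.mul_sum, ← Finset.sum_sub_distrib]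
    refine Finset.sum_congr rfl fun k hk ↦ ?_
    have hk0 : (0 : ℝ) < k := by exact_mod_cast (Finset.mem_Ioc.1 hk).1
    rw [show (1 : ℝ) / (k * x) = t / k by rw [ht]; field_simp, ← Int.self_sub_floor]
    field_simp
  rw [sum_naturalCoeff_mul_beurlingRho, hchi, sub_neg_eq_add, hsum, ht]
  field_simp
  ring

/-! ## The `L²` lower bound `‖χ + S_n‖₂ ≥ |g(n)|√n` -/

/-- `‖x ↦ x⁻¹‖_{L²(c,∞)} = √(1/c)` for `c > 0` (`∫_c^∞ x^{-2} dx = 1/c`). [folklore] -/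
theorem eLpNorm_inv_Ioi {c : ℝ} (hc : 0 < c) :
    eLpNorm (fun x : ℝ ↦ x⁻¹) 2 (volume.restrict (Ioi c)) = ENNReal.ofReal (Real.sqrt c⁻¹) := by
  rw [eLpNorm_eq_lintegral_rpow_enorm_toReal (by norm_num) (by norm_num), ENNReal.toReal_ofNat]
  have h1 : ∫⁻ x in Ioi c, ‖x⁻¹‖ₑ ^ (2 : ℝ) = ∫⁻ x in Ioi c, ENNReal.ofReal (x ^ (-2 : ℝ)) := by
    refine setLIntegral_congr_fun measurableSet_Ioi fun x (hx : c < x) ↦ ?_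
    have hx0 : 0 < x := hc.trans hx
    rw [Real.enorm_eq_ofReal (inv_nonneg.2 hx0.le),
      ENNReal.ofReal_rpow_of_nonneg (inv_nonneg.2 hx0.le) (by norm_num), Real.inv_rpow hx0.le,
      ← Real.rpow_neg hx0.le]
  have h2 : ∫⁻ x in Ioi c, ENNReal.ofReal (x ^ (-2 : ℝ)) = ENNReal.ofReal c⁻¹ := by
    rw [← ofReal_integral_eq_lintegral_ofReal (integrableOn_Ioi_rpow_of_lt (by norm_num) hc),
      integral_Ioi_rpow_of_lt (by norm_num) hc]
    · congr 1
      rw [show (-2 : ℝ) + 1 = -1 by norm_num, Real.rpow_neg_one]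
      ring
    · filter_upwards [ae_restrict_mem measurableSet_Ioi] with x (hx : c < x)
      exact Real.rpow_nonneg (hc.trans hx).le _
  rw [h1, h2, Real.sqrt_eq_rpow, ENNReal.ofReal_rpow_of_nonneg (inv_nonneg.2 hc.le) (by norm_num)]

/-- **Báez-Duarte 2000, proof of Prop. 4.4 / Prop. 4.5 (second half): `‖χ + S_n‖₂ ≥ |g(n)|√n`**
for `n ≥ 1`, since `χ + S_n = g(n)/x` on `(1/n, ∞)` and `‖g(n)/x‖_{L²(1/n,∞)} = |g(n)|√n`.
[cite: BaezDuarte2000, Prop. 4.5 (proof, first display), p. 11] -/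
theorem ofReal_moebiusHarmonic_le_naturalError {n : ℕ} (hn : 1 ≤ n) :
    ENNReal.ofReal (|moebiusHarmonic n| * Real.sqrt n) ≤ naturalError n := by
  have hn0 : (0 : ℝ) < n := by exact_mod_cast hn
  have hc : (0 : ℝ) < 1 / n := by positivity
  have hfun : (fun x : ℝ ↦ moebiusHarmonic n / x) = moebiusHarmonic n • fun x : ℝ ↦ x⁻¹ := by
    funext x
    simp [div_eq_mul_inv]
  calc ENNReal.ofReal (|moebiusHarmonic n| * Real.sqrt n)
      = eLpNorm (fun x : ℝ ↦ moebiusHarmonic n / x) 2 (volume.restrict (Ioi (1 / (n : ℝ)))) := by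
        rw [hfun, eLpNorm_const_smul, eLpNorm_inv_Ioi hc, Real.enorm_eq_ofReal_abs,
          ← ENNReal.ofReal_mul (abs_nonneg _), one_div, inv_inv]
    _ = eLpNorm (fun x : ℝ ↦
          nbChi x - ∑ j : Fin n, naturalCoeff n j * beurlingRho (((j : ℕ) : ℝ) + 1) x) 2
          (volume.restrict (Ioi (1 / (n : ℝ)))) := by
        refine eLpNorm_congr_ae ?_
        filter_upwards [ae_restrict_mem measurableSet_Ioi] with x hx
        exact (nbChi_sub_sum_naturalCoeff_eq_div hn hx).symm
    _ ≤ eLpNorm (fun x : ℝ ↦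
          nbChi x - ∑ j : Fin n, naturalCoeff n j * beurlingRho (((j : ℕ) : ℝ) + 1) x) 2
          (volume.restrict (Ioi 0)) :=
        eLpNorm_mono_measure _ (Measure.restrict_mono (Ioi_subset_Ioi hc.le) le_rfl)
    _ = naturalError n := (naturalError_eq_eLpNorm n).symm

/-- If `‖χ + S_n‖₂ → 0` then `|g(n)|√n → 0` (squeeze with `ofReal_moebiusHarmonic_le_naturalError`).
[cite: BaezDuarte2000, Prop. 4.4 (proof), p. 11] -/
theorem tendsto_moebiusHarmonic_mul_sqrt_of_tendsto (hconv : Tendsto naturalError atTop (𝓝 0)) :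
    Tendsto (fun n : ℕ ↦ |moebiusHarmonic n| * Real.sqrt n) atTop (𝓝 0) := by
  rw [ENNReal.tendsto_nhds_zero] at hconv
  rw [Metric.tendsto_nhds]
  intro ε hε
  have hev := hconv (ENNReal.ofReal (ε / 2)) (by simpa using half_pos hε)
  filter_upwards [hev, eventually_ge_atTop 1] with n hn hn1
  have hle := (ofReal_moebiusHarmonic_le_naturalError hn1).trans hn
  rw [ENNReal.ofReal_le_ofReal_iff (half_pos hε).le] at hle
  have hg0 : 0 ≤ |moebiusHarmonic n| * Real.sqrt n := by positivity
  rw [Real.dist_eq, sub_zero, abs_of_nonneg hg0]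
  linarith

/-! ## The discharge -/

/-- **Báez-Duarte 2000, Proposition 4.4 (`L²` clause for `S_n`), proved**: the natural
approximation `S_n = ∑_{k ≤ n} μ(k)ρ(1/(kx))` does not converge to `−χ` in `L²(0,∞)`,
`‖χ + S_n‖₂ ↛ 0`. Proof: `‖χ + S_n‖₂ ≥ |g(n)|√n` (`ofReal_moebiusHarmonic_le_naturalError`) and
`|g(n)|√n ↛ 0` (Cor. 2.1, `p = 2`, the tree's
`Literature.NumberTheory.LFunctions.not_tendsto_abs_sum_moebius_div_mul_sqrt`, from a zero of `ζ` on
`Re s = ½`). [cite: BaezDuarte2000, Prop. 4.4, p. 11] -/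
theorem BaezDuarte2000_prop4_4_holds : BaezDuarte2000_prop4_4 := fun hconv ↦
  Literature.NumberTheory.LFunctions.not_tendsto_abs_sum_moebius_div_mul_sqrt
    (tendsto_moebiusHarmonic_mul_sqrt_of_tendsto hconv)


/-!
# Part II. Proof of the BDBLS lower bound `liminf D(λ)√(log(1/λ)) ≥ √(∑_ρ 1/|ρ|²)` (`BDBLS2000_thm`)

This part discharges the named fact `Literature.Barriers.RiemannHypothesis.BDBLS2000_thm`
(Báez-Duarte–Balazard–Landreau–Saias 2000, as printed in Burnol 2002, Thm. 1.2) by assembling the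
Mellin-side version of Burnol's proof developed in
`Literature/NumberTheory/LFunctions/NymanBeurlingVectors*.lean`:

1. **Non-RH case** (`genError_ge_of_zero_off_line`): a zero `s₀` of `ζ` with `1/2 < re s₀ < 1`
   gives a uniform lower bound `‖χ - f‖ ≥ δ > 0` for all Beurling combinations `f` with real
   dilations `≥ 1` (the quantitative form of the elementary half of Nyman–Beurling, as in the tree's
   `Literature.NumberTheory.LFunctions.riemannHypothesis_of_beurling_closure`), so the statement is
   trivial ("the left-hand side takes the value `+∞`", Burnol §1).
2. **Duality** (`genError_ge_pairing`): for zeros `ρᵢ = 1/2 + iγᵢ` on the line, coefficients `cᵢ`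
   and `0 < λ < 1`, the vector `v = 𝓜⁻¹(conj ∑ cᵢ k_{ρᵢ})` is orthogonal to every `{1/(at)}`,
   `1 ≤ a ≤ 1/λ` (`integral_mellin_fract_mul_burnolK_eq_zero`), so for every admissible
   `f`: `‖χ - f‖ · ‖v‖ ≥ |(χ - f, v)| = |(χ, v)|` (Parseval pairing + Cauchy–Schwarz), i.e.
   `D(λ) ≥ |(χ,v)|/‖v‖`.
3. **Asymptotics** (`eventually_nbDist_ge_of_family`): with `cᵢ = conj βᵢ / w(γᵢ)`,
   `βᵢ = (ρᵢ-1)/ρᵢ⁵`, `w = |r|²`, one has `(χ,v) → ∑ |βᵢ|²/wᵢ = ∑ 1/|ρᵢ|² = S` and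
   `‖v‖²/L → S` (`tendsto_sum_integral_burnolK_div`, `tendsto_integral_norm_sq_sum_burnolK`), whence
   `L · D(λ)² ≥ S - o(1)` for every finite set of zeros on the line.
4. **Glue** (`BDBLS2000_thm_holds`): the `tsum` over the distinct nontrivial zeros is approached by
   finite sub-sums when summable and is `0` otherwise.

## References

* J.-F. Burnol, *A lower bound in an approximation problem involving the zeros of the Riemann
  zeta function*, Adv. Math. 170 (2002), 56–70; arXiv:math/0103058, Thm. 1.2 (= BDBLS),
  §§4–5.
* L. Báez-Duarte, M. Balazard, B. Landreau, E. Saias, *Notes sur la fonction ζ de Riemann, 3*,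
  Adv. Math. 149 (2000), 130–144.
-/

open Complex
open scoped Real ComplexConjugate
open Literature.NumberTheory.LFunctions Literature.NumberTheory.LFunctions.BurnolVectors

/-! ## 1. The non-RH case: a zero off the line bounds `D(λ)` away from `0` -/

/-- **Quantitative elementary half of Nyman–Beurling.** If `ζ(s₀) = 0` with `1/2 < re s₀ < 1`,
there is `δ > 0` such that `‖χ - ∑ⱼ cⱼ {1/(aⱼ x)}‖_{L²(0,∞)} ≥ δ` for all real coefficients and all
real dilations `aⱼ ≥ 1` (same argument as
`Literature.NumberTheory.LFunctions.riemannHypothesis_of_beurling_closure`: on `(1,∞)` the error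
is `-C/x`, so `|C| ≤ ‖err‖`; pairing with `x^{s₀-1}` on `(0,1]` gives
`|1/s₀ - C/(s₀-1)| ≤ ‖err‖ · ‖x^{s₀-1}‖₂`). [cite: BaezDuarte2003, Thm. 1.1] -/
theorem genError_ge_of_zero_off_line {s : ℂ} (hζ : riemannZeta s = 0) (hσ : 1 / 2 < s.re)
    (hσ1 : s.re < 1) :
    ∃ δ : ℝ, 0 < δ ∧ ∀ (n : ℕ) (a c : Fin n → ℝ), (∀ j, 1 ≤ a j) →
      ENNReal.ofReal δ ≤ genError a c := by
  set μ0 : Measure ℝ := volume.restrict (Ioi 0) with hμ0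
  have hre : 0 < s.re := by linarith
  have hs0 : s ≠ 0 := fun h ↦ by simp [h] at hre
  have hs1 : s ≠ 1 := fun h ↦ by simp [h] at hσ1
  -- the test function `g = 𝟙_{(0,1]} x^{s-1}` and its (finite) `L²` norm `M`
  set g : ℝ → ℂ := (Ioc (0 : ℝ) 1).indicator fun x ↦ (x : ℂ) ^ (s - 1) with hg
  have hgm : AEStronglyMeasurable g μ0 := by
    refine (Measurable.indicator ?_ measurableSet_Ioc).aestronglyMeasurable
    exact Complex.measurable_ofReal.pow_const _
  have hgL2 : MemLp g 2 μ0 := by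
    refine (memLp_two_iff_integrable_sq_norm hgm).2 ?_
    have hI : IntegrableOn (fun x : ℝ ↦ x ^ (2 * (s.re - 1))) (Ioc 0 1) μ0 :=
      (intervalIntegral.intervalIntegrable_rpow' (a := 0) (b := 1) (by linarith)).1.restrict
    refine (hI.integrable_indicator measurableSet_Ioc).congr ?_
    filter_upwards [ae_restrict_mem measurableSet_Ioi] with x (hx : 0 < x)
    by_cases hx1 : x ∈ Ioc (0 : ℝ) 1
    · simp only [hg, indicator_of_mem hx1, norm_cpow_eq_rpow_re_of_pos hx, sub_re, one_re]
      rw [← Real.rpow_natCast, ← Real.rpow_mul hx.le]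
      norm_num [mul_comm]
    · simp [hg, indicator_of_notMem hx1]
  set M : ℝ := (eLpNorm g 2 μ0).toReal with hM
  have hM0 : 0 ≤ M := ENNReal.toReal_nonneg
  set K : ℝ := M + ‖(1 : ℂ) / (s - 1)‖ with hK
  have hK0 : 0 ≤ K := by positivity
  have hpos : 0 < ‖(1 : ℂ) / s‖ := norm_pos_iff.2 (one_div_ne_zero hs0)
  refine ⟨‖(1 : ℂ) / s‖ / (K + 1), by positivity, fun N a c ha ↦ ?_⟩
  -- if the error is infinite there is nothing to prove
  by_cases htop : genError a c = ⊤
  · rw [htop]; exact le_top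
  set ε : ℝ := (genError a c).toReal with hε
  have hEε : genError a c = ENNReal.ofReal ε := (ENNReal.ofReal_toReal htop).symm
  have hε0 : 0 ≤ ε := ENNReal.toReal_nonneg
  -- Key estimate: `‖1/s‖ ≤ ε (M + ‖1/(s-1)‖)`.
  have key : ‖(1 : ℂ) / s‖ ≤ ε * K := by
    set D : ℝ → ℝ := fun x ↦ nbChi x - ∑ k : Fin N, c k * beurlingRho (a k) x with hD
    have hN : eLpNorm D 2 μ0 ≤ ENNReal.ofReal ε := by rw [← hEε]; exact le_rfl
    have hDm : Measurable D := by
      refine (measurable_one.indicator measurableSet_Ioc).sub (Finset.measurable_sum _ fun k _ ↦ ?_)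
      exact measurable_const.mul (measurable_fract.comp (by fun_prop))
    set C : ℝ := ∑ k : Fin N, c k / a k with hC
    ------------------------------------------------------------------
    -- (i) the tail `x > 1` gives `|C| ≤ ε`
    ------------------------------------------------------------------
    have hDtail : ∀ x : ℝ, 1 < x → D x = -C * x⁻¹ := by
      intro x hx
      have hx0 : 0 < x := by linarith
      have hxm : x ∉ Ioc (0 : ℝ) 1 := fun h' ↦ absurd h'.2 (not_le.2 hx)
      simp only [hD, nbChi, indicator_of_notMem hxm, zero_sub, hC, neg_mul, Finset.sum_mul, neg_inj]
      refine Finset.sum_congr rfl fun k _ ↦ ?_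
      have hk : (1 : ℝ) ≤ a k := ha k
      have hk0 : 0 < a k := by linarith
      rw [beurlingRho, Int.fract_eq_self.2 ⟨by positivity, ?_⟩]
      · field_simp
      · rw [div_lt_one (by positivity)]; nlinarith
    have hCε : |C| ≤ ε := by
      have h1 : eLpNorm D 2 (volume.restrict (Ioi 1)) ≤ ENNReal.ofReal ε :=
        (eLpNorm_mono_measure D (Measure.restrict_mono_set _ (Ioi_subset_Ioi zero_le_one))).trans hN
      have h2 : eLpNorm D 2 (volume.restrict (Ioi 1)) =
          eLpNorm ((-C) • fun x : ℝ ↦ x⁻¹) 2 (volume.restrict (Ioi 1)) := by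
        refine eLpNorm_congr_ae ?_
        filter_upwards [ae_restrict_mem measurableSet_Ioi] with x hx
        rw [hDtail x hx, Pi.smul_apply, smul_eq_mul]
      rw [h2, eLpNorm_const_smul, eLpNorm_inv_Ioi_one, mul_one, enorm_neg,
        Real.enorm_eq_ofReal_abs, ENNReal.ofReal_le_ofReal_iff hε0] at h1
      exact h1
    ------------------------------------------------------------------
    -- (ii) the pairing with `x^{s-1}` on `(0,1]` equals `1/s - C/(s-1)`
    ------------------------------------------------------------------
    set Dc : ℝ → ℂ := (Ioc (0 : ℝ) 1).indicator fun x ↦ (D x : ℂ) with hDc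
    have hDcm : Measurable Dc := (Complex.measurable_ofReal.comp hDm).indicator measurableSet_Ioc
    have hDc_eq : ∀ x : ℝ, Dc x = (Ioc (0 : ℝ) 1).indicator (fun _ ↦ (1 : ℂ)) x -
        ∑ k : Fin N, (c k : ℂ) * beurlingRhoTrunc (a k) x := by
      intro x
      by_cases hx : x ∈ Ioc (0 : ℝ) 1
      · simp only [hDc, hD, nbChi, beurlingRho, beurlingRhoTrunc, indicator_of_mem hx, Pi.one_apply]
        push_cast
        rfl
      · simp only [hDc, beurlingRhoTrunc, indicator_of_notMem hx, mul_zero,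
          Finset.sum_const_zero, sub_zero]
    have hmel : ∀ k : Fin N, mellin (beurlingRhoTrunc (a k)) s = 1 / ((a k : ℂ) * (s - 1)) := by
      intro k
      have := mellin_beurlingRhoTrunc_eq (k := a k) (ha k) hre hs1
      rw [this, hζ, mul_zero, zero_div, sub_zero]
    have hI : ∫ x in Ioi (0 : ℝ), (x : ℂ) ^ (s - 1) • Dc x = 1 / s - C / (s - 1) := by
      have hlin : (fun x : ℝ ↦ (x : ℂ) ^ (s - 1) • Dc x) = fun x : ℝ ↦
          (x : ℂ) ^ (s - 1) • (Ioc (0 : ℝ) 1).indicator (fun _ ↦ (1 : ℂ)) x -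
            ∑ k : Fin N, (c k : ℂ) * ((x : ℂ) ^ (s - 1) • beurlingRhoTrunc (a k) x) := by
        funext x
        rw [hDc_eq, smul_eq_mul, smul_eq_mul, mul_sub, Finset.mul_sum]
        congr 1
        exact Finset.sum_congr rfl fun k _ ↦ by rw [smul_eq_mul]; ring
      have hint1 : Integrable (fun x : ℝ ↦ (x : ℂ) ^ (s - 1) •
          (Ioc (0 : ℝ) 1).indicator (fun _ ↦ (1 : ℂ)) x) μ0 := (hasMellin_one_Ioc hre).1
      have hint2 : ∀ k : Fin N, Integrable (fun x : ℝ ↦ (c k : ℂ) *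
          ((x : ℂ) ^ (s - 1) • beurlingRhoTrunc (a k) x)) μ0 :=
        fun k ↦ (mellinConvergent_beurlingRhoTrunc _ hre).const_mul _
      rw [hlin, integral_sub hint1 (integrable_finsetSum _ fun k _ ↦ hint2 k),
        integral_finsetSum _ fun k _ ↦ hint2 k]
      have h1 : ∫ x in Ioi (0 : ℝ), (x : ℂ) ^ (s - 1) •
          (Ioc (0 : ℝ) 1).indicator (fun _ ↦ (1 : ℂ)) x = 1 / s := (hasMellin_one_Ioc hre).2
      have h2 : ∀ k : Fin N, ∫ x in Ioi (0 : ℝ), (x : ℂ) ^ (s - 1) •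
          beurlingRhoTrunc (a k) x = 1 / ((a k : ℂ) * (s - 1)) := fun k ↦ hmel k
      rw [h1, Finset.sum_congr rfl fun k _ ↦
        (integral_const_mul _ _).trans (congrArg (fun z ↦ (c k : ℂ) * z) (h2 k))]
      rw [hC]
      push_cast
      rw [Finset.sum_div]
      congr 1
      refine Finset.sum_congr rfl fun k _ ↦ ?_
      have hk : ((a k : ℝ) : ℂ) ≠ 0 := by
        have : (0 : ℝ) < a k := by linarith [ha k]
        exact_mod_cast this.ne'
      have hs2 : s - 1 ≠ 0 := sub_ne_zero.2 hs1
      field_simp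
    ------------------------------------------------------------------
    -- (iii) Cauchy–Schwarz on `(0,1]`: the pairing has norm `≤ ε M`
    ------------------------------------------------------------------
    have hIle : ‖∫ x in Ioi (0 : ℝ), (x : ℂ) ^ (s - 1) • Dc x‖ ≤ ε * M := by
      have hprod : (fun x : ℝ ↦ (x : ℂ) ^ (s - 1) • Dc x) = Dc • g := by
        funext x
        simp only [Pi.smul_apply', smul_eq_mul, hDc, hg]
        by_cases hx : x ∈ Ioc (0 : ℝ) 1
        · simp only [indicator_of_mem hx]; ring
        · simp only [indicator_of_notMem hx, mul_zero]
      have hDc2 : eLpNorm Dc 2 μ0 ≤ ENNReal.ofReal ε := by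
        refine (eLpNorm_mono fun x ↦ ?_).trans hN
        simp only [hDc]
        refine (norm_indicator_le_norm_self _ _).trans ?_
        rw [Complex.norm_real]
      have hH : eLpNorm (Dc • g) 1 μ0 ≤ ENNReal.ofReal ε * eLpNorm g 2 μ0 :=
        (eLpNorm_smul_le_mul_eLpNorm hgm hDcm.aestronglyMeasurable).trans
          (by gcongr)
      have hfin : ENNReal.ofReal ε * eLpNorm g 2 μ0 ≠ ⊤ :=
        ENNReal.mul_ne_top ENNReal.ofReal_ne_top hgL2.eLpNorm_lt_top.ne
      calc ‖∫ x in Ioi (0 : ℝ), (x : ℂ) ^ (s - 1) • Dc x‖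
          ≤ (∫⁻ x in Ioi (0 : ℝ), ENNReal.ofReal ‖(x : ℂ) ^ (s - 1) • Dc x‖).toReal :=
            norm_integral_le_lintegral_norm _
        _ = (eLpNorm (Dc • g) 1 μ0).toReal := by
            rw [← hprod, eLpNorm_one_eq_lintegral_enorm]
            simp_rw [ofReal_norm]
            rfl
        _ ≤ (ENNReal.ofReal ε * eLpNorm g 2 μ0).toReal := ENNReal.toReal_mono hfin hH
        _ = ε * M := by rw [ENNReal.toReal_mul, ENNReal.toReal_ofReal hε0]
    ------------------------------------------------------------------
    -- combine
    ------------------------------------------------------------------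
    have hCn : ‖(C : ℂ) / (s - 1)‖ ≤ ε * ‖(1 : ℂ) / (s - 1)‖ := by
      rw [norm_div, norm_div, norm_one, Complex.norm_real, Real.norm_eq_abs, ← div_eq_mul_one_div]
      exact div_le_div_of_nonneg_right hCε (norm_nonneg _)
    calc ‖(1 : ℂ) / s‖ = ‖(1 / s - C / (s - 1)) + C / (s - 1)‖ := by rw [sub_add_cancel]
      _ ≤ ‖1 / s - C / (s - 1)‖ + ‖(C : ℂ) / (s - 1)‖ := norm_add_le _ _
      _ ≤ ε * M + ε * ‖(1 : ℂ) / (s - 1)‖ := add_le_add (hI ▸ hIle) hCn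
      _ = ε * K := by rw [hK]; ring
  -- Conclusion
  rw [hEε, ENNReal.ofReal_le_ofReal_iff hε0, div_le_iff₀ (by positivity)]
  nlinarith

/-! ## 2. Duality: `D(λ) ≥ |(χ, v)| / ‖v‖` for Burnol's vectors -/

section Duality

variable {ι : Type*} [Fintype ι]

/-- The Mellin datum of the vector `v`: `M_v(s) = conj (∑ᵢ cᵢ k_{1/2+iγᵢ}(s))`; the vector is
`v = 𝓜⁻¹ M_v` (`mellinInv (1/2)`). [cite: Burnol2002, Definition 5.1] -/
def vDatum (γ : ι → ℝ) (cc : ι → ℂ) (lam : ℝ) (s : ℂ) : ℂ :=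
  conj (∑ i, cc i * burnolK ((1 / 2 : ℂ) + γ i * I) lam s)

/-- The pairing `(χ, v) = (1/2π) ∑ᵢ cᵢ ∫ kᵢ(s)/s dτ`. [cite: Burnol2002, Thm. 5.3] -/
def pairingVal (γ : ι → ℝ) (cc : ι → ℂ) (lam : ℝ) : ℂ :=
  (1 / (2 * π) : ℂ) * ∑ i, cc i *
    ∫ τ : ℝ, burnolK ((1 / 2 : ℂ) + γ i * I) lam ((1 / 2 : ℂ) + τ * I) / ((1 / 2 : ℂ) + τ * I)

/-- `‖v‖² = (1/2π) ∫ ‖∑ᵢ cᵢ kᵢ(s)‖² dτ`. [cite: Burnol2002, Thm. 5.2] -/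
def normSqVal (γ : ι → ℝ) (cc : ι → ℂ) (lam : ℝ) : ℝ :=
  (1 / (2 * π)) * ∫ τ : ℝ, ‖∑ i, cc i * burnolK ((1 / 2 : ℂ) + γ i * I) lam ((1 / 2 : ℂ) + τ * I)‖ ^ 2

/-- The Mellin datum is in `L¹ ∩ L²` on the line (`0 < λ`). [folklore] -/
theorem integrable_vDatum (γ : ι → ℝ) (cc : ι → ℂ) {lam : ℝ} (h0 : 0 < lam) :
    Integrable (fun τ : ℝ ↦ vDatum γ cc lam ((1 / 2 : ℂ) + τ * I)) ∧
      MemLp (fun τ : ℝ ↦ vDatum γ cc lam ((1 / 2 : ℂ) + τ * I)) 2 := by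
  have hsum1 : Integrable (fun τ : ℝ ↦ ∑ i, cc i * burnolK ((1 / 2 : ℂ) + γ i * I) lam ((1 / 2 : ℂ) + τ * I)) :=
    integrable_finsetSum _ fun i _ ↦ (integrable_burnolK_line h0 (γ i)).1.const_mul _
  have hsum2 : MemLp (fun τ : ℝ ↦ ∑ i, cc i * burnolK ((1 / 2 : ℂ) + γ i * I) lam ((1 / 2 : ℂ) + τ * I)) 2 :=
    memLp_finsetSum _ fun i _ ↦ (integrable_burnolK_line h0 (γ i)).2.const_mul _
  have hmeas : AEStronglyMeasurable (fun τ : ℝ ↦ vDatum γ cc lam ((1 / 2 : ℂ) + τ * I)) volume :=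
    continuous_conj.comp_aestronglyMeasurable hsum1.aestronglyMeasurable
  refine ⟨hsum1.norm.mono' hmeas (Eventually.of_forall fun τ ↦
    le_of_eq (by rw [vDatum, RCLike.norm_conj])), ?_⟩
  refine (memLp_two_iff_integrable_sq_norm hmeas).2 ?_
  have := (memLp_two_iff_integrable_sq_norm hsum2.1).1 hsum2
  exact this.congr (Eventually.of_forall fun τ ↦ by simp only [vDatum, RCLike.norm_conj])

/-- **Duality bound for a fixed `λ`.** For zeros `ρᵢ = 1/2 + iγᵢ` of `ζ`, coefficients `cᵢ`,
`0 < λ < 1`, and every Beurling combination with dilations `1 ≤ aⱼ ≤ 1/λ`: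
`‖χ - ∑ⱼ cⱼ' {1/(aⱼx)}‖_{L²(0,∞)} ≥ |(χ, v)|/‖v‖` with `v = 𝓜⁻¹ M_v` — since `v ⊥ {1/(aⱼ x)}`
(`integral_mellin_fract_mul_burnolK_eq_zero`), `(χ - f, v) = (χ, v)` (Parseval pairing
`integral_mul_conj_mellinInv`), and Cauchy–Schwarz. [cite: Burnol2002, Thm. 5.4 (proof)] -/
theorem genError_ge_pairing (γ : ι → ℝ) (hζ : ∀ i, riemannZeta ((1 / 2 : ℂ) + γ i * I) = 0)
    (cc : ι → ℂ) {lam : ℝ} (h0 : 0 < lam) (h1 : lam < 1) {n : ℕ} (a c : Fin n → ℝ)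
    (ha : ∀ j, 1 ≤ a j ∧ a j ≤ 1 / lam) :
    ENNReal.ofReal (‖pairingVal γ cc lam‖ / Real.sqrt (normSqVal γ cc lam)) ≤ genError a c := by
  set μ0 : Measure ℝ := volume.restrict (Ioi 0) with hμ0
  obtain ⟨hM1, hM2⟩ := integrable_vDatum γ cc h0
  -- the vector `v` and its norm
  set v : ℝ → ℂ := mellinInv (1 / 2) (vDatum γ cc lam) with hv
  obtain ⟨hvmem, hvn⟩ := integral_norm_sq_mellinInv hM1 hM2
  have hvn' : ∫ t in Ioi (0 : ℝ), ‖v t‖ ^ 2 = normSqVal γ cc lam := by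
    rw [hv, hvn, normSqVal]
    congr 1
    exact integral_congr_ae (Eventually.of_forall fun τ ↦ by simp only [vDatum, RCLike.norm_conj])
  have hNn : 0 ≤ normSqVal γ cc lam := by
    rw [← hvn']; exact integral_nonneg fun t ↦ by positivity
  have hvnorm : (eLpNorm v 2 μ0).toReal = Real.sqrt (normSqVal γ cc lam) := by
    rw [hvmem.eLpNorm_eq_integral_rpow_norm two_ne_zero ENNReal.ofNat_ne_top, ENNReal.toReal_ofReal
      (by positivity), Real.sqrt_eq_rpow]
    norm_num
    rw [hvn']
  -- if the error is infinite there is nothing to prove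
  by_cases htop : genError a c = ⊤
  · rw [htop]; exact le_top
  set ε : ℝ := (genError a c).toReal with hε
  have hEε : genError a c = ENNReal.ofReal ε := (ENNReal.ofReal_toReal htop).symm
  have hε0 : 0 ≤ ε := ENNReal.toReal_nonneg
  -- the complexified error function
  set Dr : ℝ → ℝ := fun x ↦ nbChi x - ∑ j : Fin n, c j * beurlingRho (a j) x with hDr
  set gC : ℝ → ℂ := fun x ↦ ((Dr x : ℝ) : ℂ) with hgC
  have hDrm : Measurable Dr := by
    refine (measurable_one.indicator measurableSet_Ioc).sub (Finset.measurable_sum _ fun j _ ↦ ?_)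
    exact measurable_const.mul (measurable_fract.comp (by fun_prop))
  have hgCm : Measurable gC := Complex.measurable_ofReal.comp hDrm
  have hgC2 : eLpNorm gC 2 μ0 = ENNReal.ofReal ε := by
    rw [← hEε]
    refine eLpNorm_congr_norm_ae (Eventually.of_forall fun x ↦ ?_)
    simp only [hgC, hDr, Complex.norm_real]
  -- its Mellin transform on the line
  have hgC_eq : ∀ x : ℝ, gC x = (Ioc (0 : ℝ) 1).indicator (fun _ ↦ (1 : ℂ)) x -
      ∑ j : Fin n, (c j : ℂ) * ((Int.fract (1 / (a j * x)) : ℝ) : ℂ) := by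
    intro x
    simp only [hgC, hDr, nbChi, beurlingRho]
    push_cast
    congr 1
    by_cases hx : x ∈ Ioc (0 : ℝ) 1
    · simp [indicator_of_mem hx]
    · simp [indicator_of_notMem hx]
  have hMel : ∀ {w : ℂ}, 0 < w.re → w.re < 1 →
      HasMellin gC w (1 / w - ∑ j : Fin n, (c j : ℂ) * ((a j : ℂ) ^ (-w) * (-riemannZeta w / w))) := by
    intro w hw0 hw1
    have hind := hasMellin_one_Ioc (s := w) hw0
    have hfr : ∀ j : Fin n, HasMellin (fun t : ℝ ↦ ((Int.fract (1 / (a j * t)) : ℝ) : ℂ)) w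
        ((a j : ℂ) ^ (-w) * (-riemannZeta w / w)) :=
      fun j ↦ BaezDuarteOnlyIf.hasMellin_fract_one_div_mul (by linarith [(ha j).1]) hw0 hw1
    have hlin : (fun t : ℝ ↦ (t : ℂ) ^ (w - 1) • gC t) = fun t : ℝ ↦
        (t : ℂ) ^ (w - 1) • (Ioc (0 : ℝ) 1).indicator (fun _ ↦ (1 : ℂ)) t -
          ∑ j : Fin n, (c j : ℂ) * ((t : ℂ) ^ (w - 1) • (((Int.fract (1 / (a j * t)) : ℝ) : ℂ))) := by
      funext t
      rw [hgC_eq, smul_sub, smul_eq_mul, smul_eq_mul, Finset.mul_sum]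
      congr 1
      exact Finset.sum_congr rfl fun j _ ↦ by rw [smul_eq_mul]; ring
    have hint2 : ∀ j : Fin n, Integrable (fun t : ℝ ↦ (c j : ℂ) *
        ((t : ℂ) ^ (w - 1) • (((Int.fract (1 / (a j * t)) : ℝ) : ℂ)))) μ0 :=
      fun j ↦ (hfr j).1.const_mul _
    refine ⟨?_, ?_⟩
    · show Integrable _ μ0
      rw [hlin]
      exact hind.1.sub (integrable_finsetSum _ fun j _ ↦ hint2 j)
    · rw [mellin, hlin, integral_sub hind.1 (integrable_finsetSum _ fun j _ ↦ hint2 j),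
        integral_finsetSum _ fun j _ ↦ hint2 j]
      have h1 : ∫ x in Ioi (0 : ℝ), (x : ℂ) ^ (w - 1) •
          (Ioc (0 : ℝ) 1).indicator (fun _ ↦ (1 : ℂ)) x = 1 / w := hind.2
      rw [h1]
      congr 1
      refine Finset.sum_congr rfl fun j _ ↦ ?_
      rw [integral_const_mul]
      exact congrArg _ (hfr j).2
  have hconv : MellinConvergent gC (1 / 2) := (hMel (by norm_num) (by norm_num)).1
  -- the Parseval pairing `∫ gC · conj v = (1/2π) ∫ 𝓜gC · (∑ cᵢ kᵢ)`
  have hpair := integral_mul_conj_mellinInv hconv hM1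
  have hP : ∫ t in Ioi (0 : ℝ), gC t * conj (v t) = pairingVal γ cc lam := by
    rw [hv, hpair, pairingVal]
    congr 1
    -- integrability of the pieces
    have hIk : ∀ i, Integrable (fun τ : ℝ ↦ burnolK ((1 / 2 : ℂ) + γ i * I) lam ((1 / 2 : ℂ) + τ * I) /
        ((1 / 2 : ℂ) + τ * I)) := fun i ↦ (integral_burnolK_div_eq_add h0 (γ i)).1
    have hIm : ∀ i j, Integrable (fun τ : ℝ ↦ ((a j : ℂ) ^ (-((1 / 2 : ℂ) + τ * I)) *
        (-riemannZeta ((1 / 2 : ℂ) + τ * I) / ((1 / 2 : ℂ) + τ * I))) *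
        burnolK ((1 / 2 : ℂ) + γ i * I) lam ((1 / 2 : ℂ) + τ * I)) :=
      fun i j ↦ integrable_mellin_fract_mul_burnolK (hζ i) h0 (ha j).1 (ha j).2
    -- pointwise form of the integrand
    have hpt : ∀ τ : ℝ, mellin gC ((1 / 2 : ℂ) + τ * I) * conj (vDatum γ cc lam ((1 / 2 : ℂ) + τ * I)) =
        ∑ i, cc i * (burnolK ((1 / 2 : ℂ) + γ i * I) lam ((1 / 2 : ℂ) + τ * I) / ((1 / 2 : ℂ) + τ * I)) -
        ∑ i, ∑ j : Fin n, (cc i * (c j : ℂ)) * (((a j : ℂ) ^ (-((1 / 2 : ℂ) + τ * I)) *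
          (-riemannZeta ((1 / 2 : ℂ) + τ * I) / ((1 / 2 : ℂ) + τ * I))) *
          burnolK ((1 / 2 : ℂ) + γ i * I) lam ((1 / 2 : ℂ) + τ * I)) := by
      intro τ
      rw [(hMel (w := (1 / 2 : ℂ) + τ * I) (by simp) (by simp; norm_num)).2, vDatum, conj_conj,
        sub_mul, Finset.mul_sum, Finset.sum_mul]
      congr 1
      · exact Finset.sum_congr rfl fun i _ ↦ by ring
      · rw [Finset.sum_comm]
        refine Finset.sum_congr rfl fun i _ ↦ ?_
        rw [Finset.mul_sum]
        exact Finset.sum_congr rfl fun j _ ↦ by ring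
    simp_rw [hpt]
    rw [integral_sub (integrable_finsetSum _ fun i _ ↦ (hIk i).const_mul _)
      (integrable_finsetSum _ fun i _ ↦ integrable_finsetSum _ fun j _ ↦ (hIm i j).const_mul _),
      integral_finsetSum _ fun i _ ↦ (hIk i).const_mul _,
      integral_finsetSum _ fun i _ ↦ integrable_finsetSum _ fun j _ ↦ (hIm i j).const_mul _]
    have hzero : ∀ i, ∑ j : Fin n, ∫ τ : ℝ, (cc i * (c j : ℂ)) * (((a j : ℂ) ^ (-((1 / 2 : ℂ) + τ * I)) *
          (-riemannZeta ((1 / 2 : ℂ) + τ * I) / ((1 / 2 : ℂ) + τ * I))) *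
          burnolK ((1 / 2 : ℂ) + γ i * I) lam ((1 / 2 : ℂ) + τ * I)) = 0 := by
      intro i
      refine Finset.sum_eq_zero fun j _ ↦ ?_
      rw [integral_const_mul, integral_mellin_fract_mul_burnolK_eq_zero (hζ i) h0 (ha j).1 (ha j).2,
        mul_zero]
    simp_rw [integral_finsetSum _ (fun j _ ↦ (hIm _ j).const_mul _), hzero, Finset.sum_const_zero,
      sub_zero]
    exact Finset.sum_congr rfl fun i _ ↦ integral_const_mul _ _
  -- Cauchy–Schwarz on `(0,∞)`
  have hCS : ‖∫ t in Ioi (0 : ℝ), gC t * conj (v t)‖ ≤ ε * Real.sqrt (normSqVal γ cc lam) := by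
    set cv : ℝ → ℂ := fun t ↦ conj (v t) with hcv
    have hcvm : AEStronglyMeasurable cv μ0 := continuous_conj.comp_aestronglyMeasurable hvmem.1
    have hcvn : eLpNorm cv 2 μ0 = eLpNorm v 2 μ0 :=
      eLpNorm_congr_norm_ae (Eventually.of_forall fun t ↦ by simp [hcv])
    have hprod : (fun t : ℝ ↦ gC t * conj (v t)) = gC • cv := by
      funext t; simp [hcv]
    have hH : eLpNorm (gC • cv) 1 μ0 ≤ ENNReal.ofReal ε * eLpNorm v 2 μ0 := by
      have := eLpNorm_smul_le_mul_eLpNorm hcvm hgCm.aestronglyMeasurable (p := 2) (q := 2) (r := 1)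
      rw [hgC2, hcvn] at this
      exact this
    have hfin : ENNReal.ofReal ε * eLpNorm v 2 μ0 ≠ ⊤ :=
      ENNReal.mul_ne_top ENNReal.ofReal_ne_top hvmem.eLpNorm_lt_top.ne
    calc ‖∫ t in Ioi (0 : ℝ), gC t * conj (v t)‖
        ≤ (∫⁻ t in Ioi (0 : ℝ), ENNReal.ofReal ‖gC t * conj (v t)‖).toReal :=
          norm_integral_le_lintegral_norm _
      _ = (eLpNorm (gC • cv) 1 μ0).toReal := by
          rw [← hprod, eLpNorm_one_eq_lintegral_enorm]
          simp_rw [ofReal_norm]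
          rfl
      _ ≤ (ENNReal.ofReal ε * eLpNorm v 2 μ0).toReal := ENNReal.toReal_mono hfin hH
      _ = ε * Real.sqrt (normSqVal γ cc lam) := by
          rw [ENNReal.toReal_mul, ENNReal.toReal_ofReal hε0, hvnorm]
  rw [hP] at hCS
  -- conclude
  rw [hEε, ENNReal.ofReal_le_ofReal_iff hε0]
  rcases eq_or_lt_of_le (Real.sqrt_nonneg (normSqVal γ cc lam)) with h | h
  · rw [← h, div_zero]; exact hε0
  · rw [div_le_iff₀ h]; exact hCS

end Duality

/-! ## 3. Asymptotics for finitely many zeros on the line -/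

section Finite

variable {ι : Type*} [Fintype ι] [DecidableEq ι]

/-- `βᵧ = (ρ - 1)/ρ⁵`, `ρ = 1/2 + iγ` (the limit `(χ, Y_ρ) → βᵧ`, up to `2π`). [cite: Burnol2002, Thm. 5.3] -/
def betaC (γ : ℝ) : ℂ :=
  (((1 / 2 : ℂ) + γ * I) - 1) / ((1 / 2 : ℂ) + γ * I) ^ 5

/-- The optimal coefficients `cᵧ = conj βᵧ / w(γ)`. [cite: Burnol2002, Thm. 5.4 (proof)] -/
def coefC (γ : ℝ) : ℂ :=
  conj (betaC γ) / (wR γ : ℂ)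

/-- `w(γ) = ‖ρ‖⁻⁶ > 0`. [folklore] -/
lemma wR_eq (γ : ℝ) : wR γ = (‖(1 / 2 : ℂ) + γ * I‖ ^ 6)⁻¹ := by
  rw [wR, norm_burnolR_line]; ring

/-- `0 < w(γ)`. [folklore] -/
lemma wR_pos' (γ : ℝ) : 0 < wR γ := by
  rw [wR_eq]
  have := half_le_norm_line γ
  positivity

/-- `‖βᵧ‖ = ‖ρ‖⁻⁴`. [folklore] -/
lemma norm_betaC (γ : ℝ) : ‖betaC γ‖ = (‖(1 / 2 : ℂ) + γ * I‖ ^ 4)⁻¹ := by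
  have h0 : ‖(1 / 2 : ℂ) + γ * I‖ ≠ 0 := by
    have := half_le_norm_line γ; exact ne_of_gt (by linarith)
  rw [betaC, norm_div, ← norm_line_eq_norm_sub_one, norm_pow]
  field_simp

/-- `‖βᵧ‖²/w(γ) = 1/‖ρ‖²`. [folklore] -/
lemma norm_sq_betaC_div_wR (γ : ℝ) : ‖betaC γ‖ ^ 2 / wR γ = 1 / ‖(1 / 2 : ℂ) + γ * I‖ ^ 2 := by
  have h0 : ‖(1 / 2 : ℂ) + γ * I‖ ≠ 0 := by
    have := half_le_norm_line γ; exact ne_of_gt (by linarith)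
  rw [norm_betaC, wR_eq]
  field_simp

/-- `cᵧ βᵧ = ‖βᵧ‖²/w(γ)` (real). [folklore] -/
lemma coefC_mul_betaC (γ : ℝ) : coefC γ * betaC γ = ((‖betaC γ‖ ^ 2 / wR γ : ℝ) : ℂ) := by
  rw [coefC, div_mul_eq_mul_div, conj_mul', ← ofReal_pow, ← ofReal_div]

/-- `‖cᵧ‖² w(γ) = ‖βᵧ‖²/w(γ)`. [folklore] -/
lemma norm_sq_coefC_mul_wR (γ : ℝ) : ‖coefC γ‖ ^ 2 * wR γ = ‖betaC γ‖ ^ 2 / wR γ := by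
  have hw := wR_pos' γ
  rw [coefC, norm_div, RCLike.norm_conj, Complex.norm_real, Real.norm_eq_abs, abs_of_pos hw]
  field_simp

/-- `nbDist` is below every admissible error (unfolding the `iInf`). [folklore] -/
lemma nbDist_le_of_forall {lam : ℝ} {b : ENNReal}
    (h : ∀ (n : ℕ) (a c : Fin n → ℝ), (∀ j, 1 ≤ a j ∧ a j ≤ 1 / lam) → b ≤ genError a c) :
    b ≤ nbDist lam :=
  le_iInf fun n ↦ le_iInf fun a ↦ le_iInf fun ha ↦ le_iInf fun c ↦ h n a c ha

/-- **`L · D(λ)² ≥ ∑ᵢ 1/|ρᵢ|² - o(1)` for a finite family of distinct zeros on the line**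
(Burnol, Thm. 5.4 restricted to `k = 0`, i.e. BDBLS's Theorem 1.2, finite form): for every
`ε > 0`, eventually as `λ → 0⁺`,
`D(λ) ≥ (√(∑ᵢ 1/|ρᵢ|²) - ε)/√(log(1/λ))`. [cite: Burnol2002, Thm. 1.2 and Thm. 5.4] -/
theorem eventually_nbDist_ge_of_family {γ : ι → ℝ} (hγ : Function.Injective γ)
    (hζ : ∀ i, riemannZeta ((1 / 2 : ℂ) + γ i * I) = 0) {ε : ℝ} (hε : 0 < ε) :
    ∀ᶠ lam : ℝ in 𝓝[>] 0,
      ENNReal.ofReal ((Real.sqrt (∑ i, 1 / ‖(1 / 2 : ℂ) + γ i * I‖ ^ 2) - ε) /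
        Real.sqrt (Real.log (1 / lam))) ≤ nbDist lam := by
  set S : ℝ := ∑ i, 1 / ‖(1 / 2 : ℂ) + γ i * I‖ ^ 2 with hSdef
  set cc : ι → ℂ := fun i ↦ coefC (γ i) with hcc
  -- trivial when the numerator is nonpositive
  by_cases ht : Real.sqrt S - ε ≤ 0
  · refine Eventually.of_forall fun lam ↦ ?_
    rw [ENNReal.ofReal_of_nonpos (div_nonpos_of_nonpos_of_nonneg ht (Real.sqrt_nonneg _))]
    exact bot_le
  rw [not_le] at ht
  set t : ℝ := Real.sqrt S - ε with htdef
  have hS0 : 0 ≤ S := Finset.sum_nonneg fun i _ ↦ by positivity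
  have hSpos : 0 < S := by
    by_contra h
    have hS : S = 0 := le_antisymm (not_lt.1 h) hS0
    rw [hS, Real.sqrt_zero] at htdef
    linarith
  have ht2 : t ^ 2 < S := by
    have h1 : t < Real.sqrt S := by rw [htdef]; linarith
    calc t ^ 2 < Real.sqrt S ^ 2 := by gcongr
      _ = S := Real.sq_sqrt hS0
  -- the limits of `(χ, v)` and of `‖v‖²/L`
  have hsumid : ∑ i, ‖betaC (γ i)‖ ^ 2 / wR (γ i) = S := by
    rw [hSdef]; exact Finset.sum_congr rfl fun i _ ↦ norm_sq_betaC_div_wR (γ i)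
  have hP : Tendsto (fun lam : ℝ ↦ pairingVal γ cc lam) (𝓝[>] 0) (𝓝 (S : ℂ)) := by
    have h := (tendsto_sum_integral_burnolK_div γ cc).const_mul (1 / (2 * π) : ℂ)
    have e : (1 / (2 * π) : ℂ) * ∑ i, cc i * (2 * π *
        ((((1 / 2 : ℂ) + γ i * I) - 1) / ((1 / 2 : ℂ) + γ i * I) ^ 5)) = (S : ℂ) := by
      have hπ : (π : ℂ) ≠ 0 := by exact_mod_cast Real.pi_ne_zero
      rw [← hsumid, ofReal_sum, Finset.mul_sum]
      refine Finset.sum_congr rfl fun i _ ↦ ?_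
      rw [← coefC_mul_betaC, hcc, betaC]
      field_simp
    rw [e] at h
    exact h
  have hN : Tendsto (fun lam : ℝ ↦ (Lof lam)⁻¹ * normSqVal γ cc lam) (𝓝[>] 0) (𝓝 S) := by
    have h := (tendsto_integral_norm_sq_sum_burnolK hγ cc).const_mul (1 / (2 * π))
    have e : 1 / (2 * π) * (2 * π * ∑ i, ‖cc i‖ ^ 2 * wR (γ i)) = S := by
      rw [← hsumid]
      have hπ : (π : ℝ) ≠ 0 := Real.pi_ne_zero
      field_simp
      exact Finset.sum_congr rfl fun i _ ↦ by rw [hcc, norm_sq_coefC_mul_wR]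
    rw [e] at h
    refine h.congr' (Eventually.of_forall fun lam ↦ ?_)
    simp only [normSqVal]; ring
  -- the quotient `Q = |P|²/(N²/L) → S > t²`
  have hQ : Tendsto (fun lam : ℝ ↦ ‖pairingVal γ cc lam‖ ^ 2 / ((Lof lam)⁻¹ * normSqVal γ cc lam))
      (𝓝[>] 0) (𝓝 (‖(S : ℂ)‖ ^ 2 / S)) :=
    ((hP.norm).pow 2).div hN hSpos.ne'
  have hQS : ‖(S : ℂ)‖ ^ 2 / S = S := by
    rw [Complex.norm_real, Real.norm_eq_abs, abs_of_pos hSpos, sq, mul_div_assoc, div_self hSpos.ne',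
      mul_one]
  rw [hQS] at hQ
  filter_upwards [hQ.eventually (lt_mem_nhds ht2), hN.eventually (lt_mem_nhds hSpos),
    BurnolVectors.eventually_mem_Ioo] with lam hq hn hlam
  have hL : 0 < Lof lam := Lof_pos hlam.1 hlam.2
  set Pn : ℝ := ‖pairingVal γ cc lam‖ with hPn
  set Nn : ℝ := normSqVal γ cc lam with hNn
  have hNpos : 0 < Nn := by
    have : 0 < (Lof lam)⁻¹ * Nn := hn
    exact pos_of_mul_pos_right this (inv_pos.2 hL).le
  -- from `Q > t²`: `t² Nn < Pn² L`, hence `t/√L ≤ Pn/√Nn`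
  have h1 : t ^ 2 * Nn < Pn ^ 2 * Lof lam := by
    have hd : 0 < (Lof lam)⁻¹ * Nn := by positivity
    have := (lt_div_iff₀ hd).1 hq
    calc t ^ 2 * Nn = (t ^ 2 * ((Lof lam)⁻¹ * Nn)) * Lof lam := by field_simp
      _ < Pn ^ 2 * Lof lam := by gcongr
  have h2 : t / Real.sqrt (Lof lam) ≤ Pn / Real.sqrt Nn := by
    rw [div_le_div_iff₀ (Real.sqrt_pos.2 hL) (Real.sqrt_pos.2 hNpos)]
    have e1 : t * Real.sqrt Nn = Real.sqrt (t ^ 2 * Nn) := by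
      rw [Real.sqrt_mul (sq_nonneg _), Real.sqrt_sq ht.le]
    have e2 : Pn * Real.sqrt (Lof lam) = Real.sqrt (Pn ^ 2 * Lof lam) := by
      rw [Real.sqrt_mul (sq_nonneg _), Real.sqrt_sq (norm_nonneg _)]
    rw [e1, e2]
    exact Real.sqrt_le_sqrt h1.le
  have hlog : Real.log (1 / lam) = Lof lam := by rw [one_div, Real.log_inv]; rfl
  rw [hlog]
  calc ENNReal.ofReal (t / Real.sqrt (Lof lam)) ≤ ENNReal.ofReal (Pn / Real.sqrt Nn) :=
      ENNReal.ofReal_le_ofReal h2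
    _ ≤ nbDist lam := nbDist_le_of_forall fun n a c ha ↦
        genError_ge_pairing γ hζ cc hlam.1 hlam.2 a c ha

end Finite

/-! ## 4. The discharge -/

/-- `√(log(1/λ)) → +∞` as `λ → 0⁺`. [folklore] -/
lemma tendsto_sqrt_log_one_div : Tendsto (fun lam : ℝ ↦ Real.sqrt (Real.log (1 / lam))) (𝓝[>] 0) atTop := by
  have h : (fun lam : ℝ ↦ Real.sqrt (Real.log (1 / lam))) = fun lam ↦ Real.sqrt (Lof lam) := by
    funext lam; rw [one_div, Real.log_inv]; rfl
  rw [h]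
  exact Real.tendsto_sqrt_atTop.comp tendsto_Lof

/-- `√a - √b ≤ ε/2` when `0 ≤ b` and `a < b + ε²/4` (`ε > 0`). [folklore] -/
lemma sqrt_sub_sqrt_le {a b ε : ℝ} (hb : 0 ≤ b) (hε : 0 < ε) (h : a < b + ε ^ 2 / 4) :
    Real.sqrt a - Real.sqrt b ≤ ε / 2 := by
  have h1 : Real.sqrt a ≤ Real.sqrt ((Real.sqrt b + ε / 2) ^ 2) := by
    refine Real.sqrt_le_sqrt ?_
    nlinarith [Real.sq_sqrt hb, Real.sqrt_nonneg b]
  rw [Real.sqrt_sq (by positivity)] at h1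
  linarith

/-- **Discharge of `BDBLS2000_thm`** (Báez-Duarte–Balazard–Landreau–Saias 2000; Burnol 2002,
Thm. 1.2): `liminf_{λ→0} D(λ)√(log(1/λ)) ≥ √(∑_ρ 1/|ρ|²)`, the sum over the distinct
nontrivial zeros. If some nontrivial zero lies off the critical line the left side is bounded
below by a positive constant times `√(log(1/λ)) → ∞` (`genError_ge_of_zero_off_line`); otherwise
all zeros are on the line, the `tsum` (zero if not summable) is approached by finite sub-sums, and
`eventually_nbDist_ge_of_family` applies. [cite: Burnol2002, Thm. 1.2] -/
theorem BDBLS2000_thm_holds : BDBLS2000_thm := by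
  classical
  intro ε hε
  by_cases hoff : ∃ ρ ∈ ZetaZeros.riemannZetaNontrivialZeros, ρ.re ≠ 1 / 2
  · -- a zero off the line: `D(λ) ≥ δ > 0`
    obtain ⟨ρ, hρ, hre⟩ := hoff
    obtain ⟨hz, h0, h1⟩ := mem_riemannZetaNontrivialZeros_iff_holds.1 hρ
    obtain ⟨s, hs, hσ, hσ1⟩ : ∃ s : ℂ, riemannZeta s = 0 ∧ 1 / 2 < s.re ∧ s.re < 1 := by
      rcases lt_or_gt_of_ne hre with hlt | hgt
      · refine ⟨1 - ρ, GeneralizedRH.riemannZeta_one_sub_eq_zero hz h0 h1, ?_, ?_⟩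
        · simp only [sub_re, one_re]; linarith
        · simp only [sub_re, one_re]; linarith
      · exact ⟨ρ, hz, hgt, h1⟩
    obtain ⟨δ, hδ, hbound⟩ := genError_ge_of_zero_off_line hs hσ hσ1
    have hnb : ∀ lam : ℝ, ENNReal.ofReal δ ≤ nbDist lam := fun lam ↦
      nbDist_le_of_forall fun n a c ha ↦ hbound n a c fun j ↦ (ha j).1
    have hlim : Tendsto (fun lam : ℝ ↦ (Real.sqrt zeroSumInvNormSq - ε) /
        Real.sqrt (Real.log (1 / lam))) (𝓝[>] 0) (𝓝 0) :=
      tendsto_const_nhds.div_atTop tendsto_sqrt_log_one_div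
    filter_upwards [hlim.eventually (gt_mem_nhds hδ)] with lam hlam
    exact (ENNReal.ofReal_le_ofReal hlam.le).trans (hnb lam)
  · -- all nontrivial zeros are on the line
    have hline : ∀ ρ ∈ ZetaZeros.riemannZetaNontrivialZeros, ρ.re = 1 / 2 := by
      intro ρ hρ; by_contra h; exact hoff ⟨ρ, hρ, h⟩
    by_cases hsum : Summable fun ρ : ZetaZeros.riemannZetaNontrivialZeros ↦ 1 / ‖(ρ : ℂ)‖ ^ 2
    · set S : ℝ := zeroSumInvNormSq with hSdef
      by_cases ht : Real.sqrt S - ε ≤ 0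
      · refine Eventually.of_forall fun lam ↦ ?_
        rw [ENNReal.ofReal_of_nonpos (div_nonpos_of_nonpos_of_nonneg ht (Real.sqrt_nonneg _))]
        exact bot_le
      rw [not_le] at ht
      -- a finite set of zeros carrying almost all of the sum
      have hS : HasSum (fun ρ : ZetaZeros.riemannZetaNontrivialZeros ↦ 1 / ‖(ρ : ℂ)‖ ^ 2) S :=
        hsum.hasSum
      have hlt : S - ε ^ 2 / 4 < S := by nlinarith
      obtain ⟨_, ⟨T, rfl⟩, hT, -⟩ :=
        (isLUB_hasSum (fun ρ ↦ by positivity) hS).exists_between hlt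
      simp only at hT
      -- the family indexed by `T`
      set γ : T → ℝ := fun x ↦ ((x : ZetaZeros.riemannZetaNontrivialZeros) : ℂ).im with hγ
      have hρeq : ∀ x : T, ((x : ZetaZeros.riemannZetaNontrivialZeros) : ℂ) = (1 / 2 : ℂ) + γ x * I := by
        intro x
        apply Complex.ext
        · simp [hline _ x.1.2]
        · simp [hγ]
      have hγinj : Function.Injective γ := by
        intro x y hxy
        have : ((x : ZetaZeros.riemannZetaNontrivialZeros) : ℂ) = (y : ZetaZeros.riemannZetaNontrivialZeros) := by
          rw [hρeq x, hρeq y, hxy]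
        exact Subtype.ext (Subtype.ext this)
      have hζ : ∀ x : T, riemannZeta ((1 / 2 : ℂ) + γ x * I) = 0 := fun x ↦ by
        rw [← hρeq x]; exact (mem_riemannZetaNontrivialZeros_iff_holds.1 x.1.2).1
      have key := eventually_nbDist_ge_of_family hγinj hζ (half_pos hε)
      -- the finite sum is `∑_{ρ ∈ T} 1/‖ρ‖²`
      have hST : ∑ x : T, 1 / ‖(1 / 2 : ℂ) + γ x * I‖ ^ 2 =
          ∑ ρ ∈ T, 1 / ‖(ρ : ℂ)‖ ^ 2 := by
        rw [← Finset.sum_coe_sort T]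
        exact Finset.sum_congr rfl fun x _ ↦ by rw [← hρeq x]
      rw [hST] at key
      have hTle : ∑ ρ ∈ T, 1 / ‖(ρ : ℂ)‖ ^ 2 ≤ S :=
        hsum.sum_le_tsum T fun ρ _ ↦ by positivity
      have hcomp : Real.sqrt S - ε ≤ Real.sqrt (∑ ρ ∈ T, 1 / ‖(ρ : ℂ)‖ ^ 2) - ε / 2 := by
        have := sqrt_sub_sqrt_le (a := S) (b := ∑ ρ ∈ T, 1 / ‖(ρ : ℂ)‖ ^ 2)
          (Finset.sum_nonneg fun ρ _ ↦ by positivity) hε (by linarith)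
        linarith
      filter_upwards [key] with lam hlam
      refine le_trans (ENNReal.ofReal_le_ofReal ?_) hlam
      exact div_le_div_of_nonneg_right hcomp (Real.sqrt_nonneg _)
    · -- not summable: the `tsum` is `0`
      have hS0 : zeroSumInvNormSq = 0 := tsum_eq_zero_of_not_summable hsum
      refine Eventually.of_forall fun lam ↦ ?_
      rw [hS0, Real.sqrt_zero, zero_sub, ENNReal.ofReal_of_nonpos]
      · exact bot_le
      · exact div_nonpos_of_nonpos_of_nonneg (by linarith) (Real.sqrt_nonneg _)

end Literature.Barriers.RiemannHypothesis
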